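import Summits.Ventures.HSemireg.WedgeHankelKernelColumnSpace
import Summits.Ventures.HSemireg.WedgeHankelOuterFamilyImageSum
import Summits.Ventures.HSemireg.WedgeHankelSiegelIdealFamily
import Summits.Ventures.HSemireg.WedgeHankelSecantKernel

/-!
# Venture HSemireg — THE JOINT KERNEL OF A FAMILY IS AN ANTITONE FUNCTION OF THE SUM OF ITS COLUMN SPACES: for two finite families of classes `w_N(q_c)`, `w_N(q′_{c′})` of one box,
# **`Σ_c col H_k(q_c) ⊆ Σ_{c′} col H_k(q′_{c′}) ⇒ Hom ⊓ ⋂_{c′} Kr(w_N q′_{c′}, k) ⊆ Hom ⊓ ⋂_c Kr(w_N q_c, k)`** (every field, no hypothesis), hence THE SUM LAW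
# **`col H_k(q₀) = Σ_c col H_k(q_c) ⇒ Kr(w_N q₀, k) = Hom ⊓ ⋂_c Kr(w_N q_c, k)`** and its image side; THE COLUMN SPACE OF A SECANT CLASS IS THE SPAN OF ITS VERONESE POINTS
# `col H_k(Σ_i A_i λ_i^•) = Σ_i K·ν_k(λ_i)` (`r ≤ N + 1 − k`), so the kernel of a secant class is the intersection of its frames in the WHOLE uniform range and does not see the weights

HONEST FRAMING. Part of the Lean index of the computation cell `pub-hsemireg` (seat p10 gen 25, Sunday typer «UNIFORM-IN-n»).
Finite-dimensional EXTERIOR ALGEBRA over a field + ranks / column spaces of Hankel matrices ONLY: no variety, no cohomology theory, no sheaf, no Ext group, no semiregularity map;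
nothing here says that HC / HC_CM / HC_AV holds; no Literature fact is declared or used.  Custodian versions as in `WedgeHankelSiegelIdeal` (1/3) and `WedgeKernelDuality` (E1); the
dictionary (`H_k(q)` = the catalecticant of `v = Σ q_j Θ^j/j!`; `col H_k(q) ⊆ K^{k+1}`; `ν_k(λ) = (λ^t)_{t ≤ k}` the Veronese point of the node `λ`) is QUOTED, never asserted.

WHAT IS IN THE TREE.  M14 (`WedgeHankelKernelColumnSpace`): `rank_hank_eq_finrank_iSup_range` (`rank [H_k(q_c)]_c = dim Σ_c col H_k(q_c)`), `Kr_w_anti_of_range_hankel1_le` (ONE class on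
each side), `Hom_iInf_Kr_w_eq_Kr_of_forall_range_le` (a family dominated by a MEMBER); J1 `finrank_iInf_Kr_w_top_add` (the joint kernel law); M11 `iSup_V_w_eq_Ann` (the joint image law);
M4 `Hom_iInf_Kr_w_eq_siegelIdeal_iff`; D1 (`WedgeHankelSecantRank`) `hankel1_secSeq` (`H_k = Bᵀ V`), `range_mulVecLin_eq_top`, `rank_wNodeMat_of_le` (Vandermonde minors);
C-series `Kr_w_expSeq` (`Kr(w_N(A λ^•), k) = F_λ(k)`), D2 `Kr_w_secSeq` (the frames' intersection for `r ≤ min(k+1, N+1−k)`), H6 `Kr_w_expMul_sum_eq_iInf_Kr_of_le` (divisors, `D ≤ N+1−k`).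
THIS FILE (namespace `Summit.Ventures.HSemireg.Wedge.HankelOuter` continued; imports M14, M11, M4, D2):
* §430 **`Hom_iInf_Kr_w_anti_of_iSup_range_le`** (two families: `Σ col(q) ≤ Σ col(q′) ⇒ J(q′) ≤ J(q)`, `J` = the joint kernel `Hom(univ,k) ⊓ ⋂ Kr`; proof: the joint kernel law
  for the UNION family `q ⊔ q′`, whose column sum is `Σ col(q′)`), `Hom_iInf_Kr_w_eq_of_iSup_range_eq`, **`Kr_w_eq_Hom_iInf_Kr_of_range_eq_iSup`** (THE SUM LAW), the image side
  `iSup_V_w_mono_of_iSup_range_le` / `iSup_V_w_eq_of_iSup_range_eq` / **`V_w_eq_iSup_V_of_range_eq_iSup`** (`k + k′ = N`), and `Hom_iInf_Kr_w_eq_siegelIdeal_iff_iSup_range_eq_top`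
  (`k ≤ N`: `J(q) = SI_k ↔ Σ_c col H_k(q_c) = K^{k+1}`, M4 in column-space form).
* §431 EXPLICIT COLUMN SPACES: **`range_hankel1_mulVecLin_secSeq`** (`col H_k(Σ_{i<r} A_i λ_i^•) = Σ_i K·ν_k(λ_i)` for distinct nodes, non-zero weights, `r ≤ N + 1 − k`),
  `range_hankel1_mulVecLin_expSeq` (`col H_k(A λ^•) = K·ν_k(λ)`, `k ≤ N`), `iSup_span_veronese_eq_top` (`k + 1 ≤ r` distinct nodes: `Σ_i K·ν_k(λ_i) = K^{k+1}`).
* §432 READINGS: **`Kr_w_secSeq_eq_Hom_iInf_frameIdeal`** (`0 < r ≤ N + 1 − k`, `1 ≤ k`: `Kr(w_N(Σ A_i λ_i^•), k) = Hom ⊓ ⋂_i F_{λ_i}(k)` — the WHOLE uniform range, no `r ≤ k + 1`;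
  D2 and D3/F2c are its two halves), **`Kr_w_secSeq_eq_of_weights`** / `V_w_secSeq_eq_of_weights` (KERNELS AND IMAGES SEE THE NODES, NOT THE WEIGHTS, `r ≤ N + 1 − k`),
  `Hom_iInf_Kr_w_expSeq_eq_Kr_w_secSeq` (the joint kernel of the `r` pure classes IS the kernel of any secant class on the same nodes).
READING: M14 made the kernel a function of `col H_k(q)`; here that function is extended to families (`Σ_c col ↦ ⋂_c Kr`) and shown to turn sums into intersections — the frames' intersection
laws of the atlas (D2, D3, G3, H6 for secants) are its values on spans of Veronese points.  NOT typed here: the osculating flats of higher-order nodes (`col H_k` of `expMul λ q`), the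
fourth regime `r > N + 1 − k` (where `col` is a proper subspace of the Veronese span and depends on the weights).  Nothing Ext-side.  New names only.
-/

open Module
open scoped Matrix

namespace Summit.Ventures.HSemireg.Wedge.HankelOuter

open Summit.Ventures.HSemireg.Wedge Summit.Ventures.HSemireg.Wedge.Kunneth Summit.Ventures.HSemireg.Wedge.Hankel
  Summit.Ventures.HSemireg.Wedge.BasisFree Summit.Ventures.HSemireg.Wedge.HankelSiegel Summit.Ventures.HSemireg.Wedge.HankelSiegelIdeal
  Summit.Ventures.HSemireg.Wedge.KunnethKernel Summit.Ventures.HSemireg.Wedge.HankelFrameChange Summit.Ventures.HSemireg.Wedge.KernelDuality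
  Summit.Ventures.HSemireg.Wedge.HankelSecant Summit.Ventures.HSemireg.Wedge.HankelPureKernel Summit.Ventures.HSemireg.Wedge.HankelFaces

variable (K : Type*) [Field K] {N : ℕ} {ι ι' : Type} [Fintype ι] [DecidableEq ι] [Fintype ι'] [DecidableEq ι']

/-! ## §430. The joint kernel of a family is an antitone function of the sum of its column spaces -/

/-- the joint kernel law in column-space form: **`dim (Hom(univ,k) ⊓ ⋂_c Kr(univ, w_N q_c, k)) + C(N,k) · dim (Σ_c col H_k(q_c)) = C(2N,k)`** (J1 + M14). -/
theorem finrank_Hom_iInf_Kr_w_add_finrank_iSup_range (k : ℕ) (q : ι → ℕ → K) :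
    finrank K ↥(Hom K (In N) (Finset.univ : Finset (In N)) k ⊓ ⨅ c, Kr K (Finset.univ : Finset (In N)) (w K N N (q c)) k)
      + N.choose k * finrank K ↥(⨆ c, LinearMap.range (hankel1 K N k (q c)).mulVecLin) = (N + N).choose k := by
  rw [← rank_hank_eq_finrank_iSup_range]
  exact finrank_iInf_Kr_w_top_add K k q

omit [Fintype ι] [DecidableEq ι] [Fintype ι'] [DecidableEq ι'] in
/-- the joint kernel of a disjoint union of two families is the intersection of the two joint kernels. -/
theorem Hom_iInf_Kr_w_sum (k : ℕ) (q : ι → ℕ → K) (q' : ι' → ℕ → K) :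
    Hom K (In N) (Finset.univ : Finset (In N)) k ⊓ (⨅ c, Kr K (Finset.univ : Finset (In N)) (w K N N (Sum.elim q q' c)) k)
      = (Hom K (In N) (Finset.univ : Finset (In N)) k ⊓ ⨅ c, Kr K (Finset.univ : Finset (In N)) (w K N N (q c)) k)
          ⊓ (Hom K (In N) (Finset.univ : Finset (In N)) k ⊓ ⨅ c, Kr K (Finset.univ : Finset (In N)) (w K N N (q' c)) k) := by
  rw [iInf_sum]
  simp only [Sum.elim_inl, Sum.elim_inr]
  exact inf_inf_distrib_left _ _ _

omit [Fintype ι] [DecidableEq ι] [Fintype ι'] [DecidableEq ι'] in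
/-- the column sum of a disjoint union of two families is the sum of the two column sums. -/
theorem iSup_range_hankel1_sum (k : ℕ) (q : ι → ℕ → K) (q' : ι' → ℕ → K) :
    (⨆ c, LinearMap.range (hankel1 K N k (Sum.elim q q' c)).mulVecLin)
      = (⨆ c, LinearMap.range (hankel1 K N k (q c)).mulVecLin) ⊔ (⨆ c, LinearMap.range (hankel1 K N k (q' c)).mulVecLin) := by
  rw [iSup_sum]
  simp only [Sum.elim_inl, Sum.elim_inr]

/-- **THE JOINT KERNEL OF A FAMILY IS AN ANTITONE FUNCTION OF THE SUM OF ITS COLUMN SPACES: `Σ_c col H_k(q_c) ⊆ Σ_{c′} col H_k(q′_{c′}) ⇒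
Hom(univ,k) ⊓ ⋂_{c′} Kr(univ, w_N q′_{c′}, k) ⊆ Hom(univ,k) ⊓ ⋂_c Kr(univ, w_N q_c, k)`** (every field, every `N`, `k`, any two finite families) — the joint kernel law for the union family
`q ⊔ q′` (whose column sum is that of `q′`) and for `q′` give the same dimension, so `J(q) ⊓ J(q′) = J(q′)`. -/
theorem Hom_iInf_Kr_w_anti_of_iSup_range_le (k : ℕ) {q : ι → ℕ → K} {q' : ι' → ℕ → K}
    (h : (⨆ c, LinearMap.range (hankel1 K N k (q c)).mulVecLin) ≤ ⨆ c, LinearMap.range (hankel1 K N k (q' c)).mulVecLin) :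
    Hom K (In N) (Finset.univ : Finset (In N)) k ⊓ (⨅ c, Kr K (Finset.univ : Finset (In N)) (w K N N (q' c)) k)
      ≤ Hom K (In N) (Finset.univ : Finset (In N)) k ⊓ ⨅ c, Kr K (Finset.univ : Finset (In N)) (w K N N (q c)) k := by
  have hs : (⨆ c, LinearMap.range (hankel1 K N k (Sum.elim q q' c)).mulVecLin) = ⨆ c, LinearMap.range (hankel1 K N k (q' c)).mulVecLin := by
    rw [iSup_range_hankel1_sum]
    exact sup_eq_right.mpr h
  have h1 := finrank_Hom_iInf_Kr_w_add_finrank_iSup_range K (N := N) k (Sum.elim q q')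
  have h2 := finrank_Hom_iInf_Kr_w_add_finrank_iSup_range K (N := N) k q'
  rw [hs, Hom_iInf_Kr_w_sum] at h1
  have heq := Submodule.eq_of_le_of_finrank_eq
    (inf_le_right : (Hom K (In N) (Finset.univ : Finset (In N)) k ⊓ ⨅ c, Kr K (Finset.univ : Finset (In N)) (w K N N (q c)) k)
        ⊓ (Hom K (In N) (Finset.univ : Finset (In N)) k ⊓ ⨅ c, Kr K (Finset.univ : Finset (In N)) (w K N N (q' c)) k)
      ≤ Hom K (In N) (Finset.univ : Finset (In N)) k ⊓ ⨅ c, Kr K (Finset.univ : Finset (In N)) (w K N N (q' c)) k) (by omega)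
  exact inf_eq_right.mp heq

/-- **EQUAL COLUMN SUMS ⇒ EQUAL JOINT KERNELS** (any two finite families of one box, every field). -/
theorem Hom_iInf_Kr_w_eq_of_iSup_range_eq (k : ℕ) {q : ι → ℕ → K} {q' : ι' → ℕ → K}
    (h : (⨆ c, LinearMap.range (hankel1 K N k (q c)).mulVecLin) = ⨆ c, LinearMap.range (hankel1 K N k (q' c)).mulVecLin) :
    Hom K (In N) (Finset.univ : Finset (In N)) k ⊓ (⨅ c, Kr K (Finset.univ : Finset (In N)) (w K N N (q c)) k)
      = Hom K (In N) (Finset.univ : Finset (In N)) k ⊓ ⨅ c, Kr K (Finset.univ : Finset (In N)) (w K N N (q' c)) k :=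
  le_antisymm (Hom_iInf_Kr_w_anti_of_iSup_range_le K k h.ge) (Hom_iInf_Kr_w_anti_of_iSup_range_le K k h.le)

omit [Fintype ι'] [DecidableEq ι'] in
/-- **THE SUM LAW: `col H_k(q₀) = Σ_c col H_k(q_c) ⇒ Kr(univ, w_N q₀, k) = Hom(univ,k) ⊓ ⋂_c Kr(univ, w_N q_c, k)`** — the kernel map of M14 turns sums of column spaces into
intersections of kernels (every field; `q₀` need not be a member of the family). -/
theorem Kr_w_eq_Hom_iInf_Kr_of_range_eq_iSup (k : ℕ) {q₀ : ℕ → K} {q : ι → ℕ → K}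
    (h : LinearMap.range (hankel1 K N k q₀).mulVecLin = ⨆ c, LinearMap.range (hankel1 K N k (q c)).mulVecLin) :
    Kr K (Finset.univ : Finset (In N)) (w K N N q₀) k = Hom K (In N) (Finset.univ : Finset (In N)) k ⊓ ⨅ c, Kr K (Finset.univ : Finset (In N)) (w K N N (q c)) k := by
  have e : Hom K (In N) (Finset.univ : Finset (In N)) k ⊓ (⨅ _ : Unit, Kr K (Finset.univ : Finset (In N)) (w K N N q₀) k) = Kr K (Finset.univ : Finset (In N)) (w K N N q₀) k := by
    rw [iInf_const]
    exact inf_eq_right.mpr (Kr_le_Hom K _ _ _)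
  rw [← e]
  exact Hom_iInf_Kr_w_eq_of_iSup_range_eq K k (q := fun _ : Unit => q₀) (q' := q) (by rw [iSup_const]; exact h)

/-- the image side: **`Σ_c col H_k(q_c) ⊆ Σ_{c′} col H_k(q′_{c′}) ⇒ ⨆_c V(univ, w_N q_c, k′) ⊆ ⨆_{c′} V(univ, w_N q′_{c′}, k′)`** for `k + k′ = N` (M11's joint image law + E1). -/
theorem iSup_V_w_mono_of_iSup_range_le {k k' : ℕ} (hkk' : k + k' = N) {q : ι → ℕ → K} {q' : ι' → ℕ → K}
    (h : (⨆ c, LinearMap.range (hankel1 K N k (q c)).mulVecLin) ≤ ⨆ c, LinearMap.range (hankel1 K N k (q' c)).mulVecLin) :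
    (⨆ c, V K (In N) Finset.univ (w K N N (q c)) k') ≤ ⨆ c, V K (In N) Finset.univ (w K N N (q' c)) k' := by
  rw [iSup_V_w_eq_Ann K hkk' q, iSup_V_w_eq_Ann K hkk' q']
  exact Ann_anti K _ (Hom_iInf_Kr_w_anti_of_iSup_range_le K k h)

/-- **equal column sums ⇒ equal joint images** (`k + k′ = N`). -/
theorem iSup_V_w_eq_of_iSup_range_eq {k k' : ℕ} (hkk' : k + k' = N) {q : ι → ℕ → K} {q' : ι' → ℕ → K}
    (h : (⨆ c, LinearMap.range (hankel1 K N k (q c)).mulVecLin) = ⨆ c, LinearMap.range (hankel1 K N k (q' c)).mulVecLin) :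
    (⨆ c, V K (In N) Finset.univ (w K N N (q c)) k') = ⨆ c, V K (In N) Finset.univ (w K N N (q' c)) k' :=
  le_antisymm (iSup_V_w_mono_of_iSup_range_le K hkk' h.le) (iSup_V_w_mono_of_iSup_range_le K hkk' h.ge)

omit [Fintype ι'] [DecidableEq ι'] in
/-- **THE SUM LAW, IMAGE SIDE: `col H_k(q₀) = Σ_c col H_k(q_c) ⇒ V(univ, w_N q₀, k′) = ⨆_c V(univ, w_N q_c, k′)`** (`k + k′ = N`). -/
theorem V_w_eq_iSup_V_of_range_eq_iSup {k k' : ℕ} (hkk' : k + k' = N) {q₀ : ℕ → K} {q : ι → ℕ → K}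
    (h : LinearMap.range (hankel1 K N k q₀).mulVecLin = ⨆ c, LinearMap.range (hankel1 K N k (q c)).mulVecLin) :
    V K (In N) Finset.univ (w K N N q₀) k' = ⨆ c, V K (In N) Finset.univ (w K N N (q c)) k' := by
  have e : (⨆ _ : Unit, V K (In N) Finset.univ (w K N N q₀) k') = V K (In N) Finset.univ (w K N N q₀) k' := iSup_const
  rw [← e]
  exact iSup_V_w_eq_of_iSup_range_eq K hkk' (q := fun _ : Unit => q₀) (q' := q) (by rw [iSup_const]; exact h)

omit [Fintype ι'] [DecidableEq ι'] in
/-- M4 in column-space form: for `k ≤ N`, **`Hom(univ,k) ⊓ ⋂_c Kr(univ, w_N q_c, k) = SI_k ↔ Σ_c col H_k(q_c) = K^{k+1}`.** -/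
theorem Hom_iInf_Kr_w_eq_siegelIdeal_iff_iSup_range_eq_top {k : ℕ} (hk : k ≤ N) (q : ι → ℕ → K) :
    Hom K (In N) (Finset.univ : Finset (In N)) k ⊓ (⨅ c, Kr K (Finset.univ : Finset (In N)) (w K N N (q c)) k) = siegelIdeal K N k
      ↔ (⨆ c, LinearMap.range (hankel1 K N k (q c)).mulVecLin) = ⊤ := by
  rw [Hom_iInf_Kr_w_eq_siegelIdeal_iff, rank_hank_eq_finrank_iSup_range]
  constructor
  · rintro (h | h)
    · omega
    · exact Submodule.eq_top_of_finrank_eq (by rw [h, finrank_fintype_fun_eq_card, Fintype.card_fin])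
  · intro h
    right
    rw [h, finrank_top, finrank_fintype_fun_eq_card, Fintype.card_fin]

/-! ## §431. Explicit column spaces: secant classes and Veronese points -/

/-- **THE COLUMN SPACE OF AN `r`-SECANT CLASS IS THE SPAN OF ITS VERONESE POINTS: `col H_k(Σ_{i<r} A_i λ_i^•) = Σ_i K · ν_k(λ_i)`**, `ν_k(λ) = (λ^t)_{t ≤ k}`, for distinct nodes,
non-zero weights and `r ≤ N + 1 − k` (D1: `H_k = Bᵀ V` with `V` onto `K^r`; the columns of `Bᵀ` are the `A_i ν_k(λ_i)`). -/
theorem range_hankel1_mulVecLin_secSeq {k r : ℕ} (hr : r ≤ N + 1 - k) {A lam : Fin r → K} (hA : ∀ i, A i ≠ 0) (hlam : Function.Injective lam) :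
    LinearMap.range (hankel1 K N k (secSeq K A lam)).mulVecLin = ⨆ i, K ∙ (fun t : Fin (k + 1) => lam i ^ (t : ℕ)) := by
  rw [hankel1_secSeq, Matrix.mulVecLin_mul, LinearMap.range_comp_of_range_eq_top _ (range_mulVecLin_eq_top hr (fun _ => one_ne_zero) hlam),
    Matrix.range_mulVecLin, Submodule.span_range_eq_iSup]
  refine iSup_congr fun i => ?_
  have hc : (wNodeMat A lam (k + 1))ᵀ.col i = A i • (fun t : Fin (k + 1) => lam i ^ (t : ℕ)) := by
    funext t
    rfl
  rw [hc, Submodule.span_singleton_smul_eq (hA i).isUnit]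

/-- **`col H_k(A λ^•) = K · ν_k(λ)`** — the Veronese point of the node (`A ≠ 0`, `k ≤ N`). -/
theorem range_hankel1_mulVecLin_expSeq {k : ℕ} (hk : k ≤ N) {A : K} (hA : A ≠ 0) (lam : K) :
    LinearMap.range (hankel1 K N k (expSeq K A lam)).mulVecLin = K ∙ (fun t : Fin (k + 1) => lam ^ (t : ℕ)) := by
  have e : expSeq K A lam = secSeq K (fun _ : Fin 1 => A) (fun _ : Fin 1 => lam) := by
    funext j
    simp [secSeq, expSeq]
  rw [e, range_hankel1_mulVecLin_secSeq K (by omega : 1 ≤ N + 1 - k) (fun _ => hA) (Function.injective_of_subsingleton _)]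
  exact iSup_const

/-- **`k + 1` DISTINCT VERONESE POINTS SPAN: `Σ_{i<r} K · ν_k(λ_i) = K^{k+1}` for `k + 1 ≤ r` distinct nodes** (a Vandermonde minor, D1 `rank_wNodeMat_of_le`). -/
theorem iSup_span_veronese_eq_top {k r : ℕ} (hkr : k + 1 ≤ r) {lam : Fin r → K} (hlam : Function.Injective lam) :
    (⨆ i, K ∙ (fun t : Fin (k + 1) => lam i ^ (t : ℕ))) = ⊤ := by
  have hcol : (⨆ i, K ∙ (fun t : Fin (k + 1) => lam i ^ (t : ℕ))) = LinearMap.range ((wNodeMat (fun _ => (1 : K)) lam (k + 1))ᵀ).mulVecLin := by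
    rw [Matrix.range_mulVecLin, Submodule.span_range_eq_iSup]
    refine iSup_congr fun i => ?_
    have hc : (wNodeMat (fun _ => (1 : K)) lam (k + 1))ᵀ.col i = (fun t : Fin (k + 1) => lam i ^ (t : ℕ)) := by
      funext t
      simp [Matrix.col_apply, wNodeMat_apply]
    rw [hc]
  rw [hcol]
  apply Submodule.eq_top_of_finrank_eq
  rw [← Matrix.rank, Matrix.rank_transpose, rank_wNodeMat_of_le hkr (fun _ => one_ne_zero) hlam, finrank_fintype_fun_eq_card, Fintype.card_fin]

/-! ## §432. Readings: secant kernels are intersections of frames in the whole uniform range, and do not see the weights -/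

/-- **`Kr(univ, w_N(Σ_{i<r} A_i λ_i^•), k) = Hom(univ,k) ⊓ ⋂_i F_{λ_i}(k)` for `0 < r ≤ N + 1 − k`, `1 ≤ k`** (distinct nodes, non-zero weights; NO `r ≤ k + 1`): the SUM LAW on the
Veronese points (`col H_k(A λ^•) = K·ν_k(λ)`, C6 `Kr_w_expSeq`).  D2 (`r ≤ k + 1`: the frames' intersection) and D3/F2c (`r ≥ k + 1`: `SI_k`) are its two halves. -/
theorem Kr_w_secSeq_eq_Hom_iInf_frameIdeal {k r : ℕ} (hr0 : 0 < r) (hk : 1 ≤ k) (hr : r ≤ N + 1 - k) {A lam : Fin r → K} (hA : ∀ i, A i ≠ 0)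
    (hlam : Function.Injective lam) :
    Kr K (Finset.univ : Finset (In N)) (w K N N (secSeq K A lam)) k = Hom K (In N) (Finset.univ : Finset (In N)) k ⊓ ⨅ i, frameIdeal K N (uvec K N (lam i)) k := by
  have hkN : k ≤ N := by omega
  rw [Kr_w_eq_Hom_iInf_Kr_of_range_eq_iSup K k (q₀ := secSeq K A lam) (q := fun i => expSeq K (A i) (lam i)) ?_]
  · congr 1
    exact iInf_congr fun i => Kr_w_expSeq K N (hA i) (lam i) hk
  · rw [range_hankel1_mulVecLin_secSeq K hr hA hlam]
    exact iSup_congr fun i => (range_hankel1_mulVecLin_expSeq K hkN (hA i) (lam i)).symm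

/-- **the joint kernel of the `r` pure classes `A_i λ_i^•` IS the kernel of the secant class `Σ_i A_i λ_i^•`** (`r ≤ N + 1 − k`, distinct nodes, non-zero weights; every `k`). -/
theorem Hom_iInf_Kr_w_expSeq_eq_Kr_w_secSeq {k r : ℕ} (hr : r ≤ N + 1 - k) {A lam : Fin r → K} (hA : ∀ i, A i ≠ 0) (hlam : Function.Injective lam) :
    Hom K (In N) (Finset.univ : Finset (In N)) k ⊓ (⨅ i, Kr K (Finset.univ : Finset (In N)) (w K N N (expSeq K (A i) (lam i))) k)
      = Kr K (Finset.univ : Finset (In N)) (w K N N (secSeq K A lam)) k := by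
  rcases Nat.eq_zero_or_pos r with hr0 | hr0
  · subst hr0
    have hw : w K N N (secSeq K A lam) = 0 := by
      rw [secSeq_zero, show (0 : ℕ → K) = (0 : K) • (0 : ℕ → K) from (zero_smul K _).symm, w_smul', zero_smul]
    rw [iInf_of_empty, inf_top_eq, hw]
    exact le_antisymm (fun θ hθ => mem_Kr.mpr ⟨hθ, mul_zero θ⟩) (Kr_le_Hom K _ _ _)
  · have hkN : k ≤ N := by omega
    refine (Kr_w_eq_Hom_iInf_Kr_of_range_eq_iSup K k ?_).symm
    rw [range_hankel1_mulVecLin_secSeq K hr hA hlam]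
    exact iSup_congr fun i => (range_hankel1_mulVecLin_expSeq K hkN (hA i) (lam i)).symm

/-- **KERNELS SEE THE NODES, NOT THE WEIGHTS: `Kr(univ, w_N(Σ A_i λ_i^•), k) = Kr(univ, w_N(Σ B_i λ_i^•), k)`** for any two systems of non-zero weights on the same distinct nodes
(`r ≤ N + 1 − k`; M14 `Kr_w_eq_of_range_hankel1_eq` on equal column spaces). -/
theorem Kr_w_secSeq_eq_of_weights {k r : ℕ} (hr : r ≤ N + 1 - k) {A B lam : Fin r → K} (hA : ∀ i, A i ≠ 0) (hB : ∀ i, B i ≠ 0) (hlam : Function.Injective lam) :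
    Kr K (Finset.univ : Finset (In N)) (w K N N (secSeq K A lam)) k = Kr K (Finset.univ : Finset (In N)) (w K N N (secSeq K B lam)) k :=
  Kr_w_eq_of_range_hankel1_eq K k (q := secSeq K A lam) (q' := secSeq K B lam)
    (by rw [range_hankel1_mulVecLin_secSeq K hr hA hlam, range_hankel1_mulVecLin_secSeq K hr hB hlam])

/-- … and the images: **`V(univ, w_N(Σ A_i λ_i^•), k′) = V(univ, w_N(Σ B_i λ_i^•), k′)`** (`k + k′ = N`, `r ≤ N + 1 − k`). -/
theorem V_w_secSeq_eq_of_weights {k k' r : ℕ} (hkk' : k + k' = N) (hr : r ≤ N + 1 - k) {A B lam : Fin r → K} (hA : ∀ i, A i ≠ 0) (hB : ∀ i, B i ≠ 0)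
    (hlam : Function.Injective lam) :
    V K (In N) Finset.univ (w K N N (secSeq K A lam)) k' = V K (In N) Finset.univ (w K N N (secSeq K B lam)) k' :=
  V_w_eq_of_range_hankel1_eq K hkk' (q := secSeq K A lam) (q' := secSeq K B lam)
    (by rw [range_hankel1_mulVecLin_secSeq K hr hA hlam, range_hankel1_mulVecLin_secSeq K hr hB hlam])

end Summit.Ventures.HSemireg.Wedge.HankelOuter
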